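import Summits.Ventures.HSemireg.WedgeHankelNodeImageTop
import Summits.Ventures.HSemireg.WedgeHankelTwoNodes

/-!
# Venture HSemireg — THE BLOCK ANNIHILATOR LAW: `Ann_j(⨆_{a ∈ S} plane(a, k−a)) = ⨆_{c : a + c ≠ n ∀ a ∈ S} plane(c, j−c)` (`k + j = 2n`);
# `xyRich = xRich ⊓ yRich`, `Ann(yRich)`, `Ann(xyRich) = xRich ⊔ yRich`, and the image of a two-node class in EVERY degree `k′ ≥ P + P′ + 1`

HONEST FRAMING. Part of the Lean index of the computation cell `pub-hsemireg` (seat p10 gen 17, Sunday typer «UNIFORM-IN-n»).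
Finite-dimensional EXTERIOR ALGEBRA over a field ONLY: no variety, no cohomology theory, no sheaf, no Ext group, no semiregularity map;
nothing here says that HC / HC_CM / HC_AV holds; no Literature fact is declared or used.  Custodian versions as in `WedgeHankelSiegelIdeal` (1/3) and
`WedgeKernelDuality`; the dictionary (`plane(a,b) ↔ H^b(⋀^a T)`; `θ ↦ θ ∧ w_n(q)` ↔ `⌟v`; images of `⌟v`) is QUOTED, never asserted.

WHAT IS IN THE TREE.  E2 `WedgeHankelPlaneProjections` (the projections `prj a b`, the grading `θ = Σ_a prj a (k−a) θ`, planes meet in `0`); E3/E4/E8 (`xRich`, `yRich`,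
`xyRich` with `xyRich ≤ xRich ⊓ yRich` only); E1 `WedgeKernelDuality` (`Ann`, `Ann_sup`, `Ann_inf`, `Ann_Ann`, `V_w_eq_Ann`); F4 (`coSiegel`, `Ann_siegelIdeal`); F4b
(`Ann_xRich`, `topCoeff_eq_zero_of_mem_plane`, `topCoeff_mul_B_eq_topCoeff_prj_mul_B`); F7 (the node at `∞` by the swap); F8 (the two-node IMAGE, in the range
`P + P′ + 2 ≤ min(k′+1, n+1−k′)` of the P¹ divisor rank law).  THIS FILE (namespace `Summit.Ventures.HSemireg.Wedge.KernelDuality` continued; imports F7, E8):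
* §80 SUMS OF BLOCKS BY x-COUNT `⨆_{a ∈ S} plane(a, k−a)`: the PROJECTION CRITERION `mem_biSup_plane_iff` (`θ ∈ ⋀^k` lies in the sum iff its components of
  x-count outside `S` vanish), **`biSup_plane_inf`: `(⨆_{S} …) ⊓ (⨆_{S′} …) = ⨆_{S ∩ S′} …`** (E2's independence of the blocks, element form), `yRich` by x-count
  (`yRich_eq_biSup`), and **`xyRich_eq_inf`: `xyRich(k, P, P′) = xRich(k, P) ⊓ yRich(k, P′)`** (E8 had `≤`).
* §81 **THE BLOCK ANNIHILATOR LAW `Ann_biSup_plane`**: for `k + j = 2n` and any set `S` of x-counts, `Ann_j(⨆_{a ∈ S} plane(a, k−a)) = ⨆_{c ≤ j, a + c ≠ n ∀ a ∈ S} plane(c, j−c)`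
  — a block `plane(a, k−a)` pairs non-trivially ONLY with its complementary block `plane(n−a, n−k+a)` (⊇ letter count; ⊆ E1's non-degeneracy on each projection,
  as in F4b's `Ann_xRich`); `plane_eq_bot_of_lt` (no block has more than `n` x-letters); corollaries **`Ann_plane`**, **`Ann_yRich`: `Ann_j(yRich(k, P′)) =
  yRich(j, n−P′−1)`**, **`Ann_xyRich`: `Ann_j(xyRich(k,P,P′)) = xRich(j, n−P−1) ⊔ yRich(j, n−P′−1)`** (E1 `Ann_inf`), `Ann_xRich_sup_yRich` (= `xyRich(j, n−P−1, n−P′−1)`).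
* §82 **THE IMAGE OF A TWO-NODE CLASS IN EVERY DEGREE**: for `q` supported on `[0,P] ∪ [n−P′, n]`, `q_P ≠ 0 ≠ q_{n−P′}`, `k + k′ = n` and ONLY `P + P′ + 1 ≤ k′`:
  **`V_w_of_two_orders_eq`: `V(univ, w_n(q), k′) = coSiegel(k′+n) ⊓ (xRich(k′+n, n−P−1) ⊔ yRich(k′+n, n−P′−1))`** — E1's duality on E8's kernel law in the mirror
  degree `k = n − k′`; F8's split name `(coSiegel ⊓ xRich) ⊔ (coSiegel ⊓ yRich)` needs `P + P′ + 2 ≤ n + 1 − k′` as well, this one does not (`V_w_of_two_orders_eq_of_le`: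
  the two agree where F8 applies; in general the split form is `≤`, `sup_inf_le_V_w_of_two_orders`).
NOT typed here: the transports to the nodes `(λ, ∞)` / `(λ, μ)` of §82 (E9 / F1 kernel laws + `Φs`, `Gs`; sequel), annihilators of frame-changed block sums;
anything Ext-side.  Class side only; new names only.
-/

open Module

namespace Summit.Ventures.HSemireg.Wedge.KernelDuality

open Summit.Ventures.HSemireg.Wedge Summit.Ventures.HSemireg.Wedge.Kunneth Summit.Ventures.HSemireg.Wedge.Hankel
  Summit.Ventures.HSemireg.Wedge.HankelSiegel Summit.Ventures.HSemireg.Wedge.HankelSiegelIdeal Summit.Ventures.HSemireg.Wedge.KunnethKernel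
  Summit.Ventures.HSemireg.Wedge.HankelSecant Summit.Ventures.HSemireg.Wedge.HankelFrameChange

variable (K : Type*) [Field K] {n : ℕ}

/-! ## §80. Sums of blocks by x-count: the projection criterion, intersections, `xyRich = xRich ⊓ yRich` -/

/-- **NO BLOCK HAS MORE THAN `n` x-LETTERS: `plane(a, b) = ⊥` for `a > n`.** -/
lemma plane_eq_bot_of_lt {a : ℕ} (ha : n < a) (b : ℕ) : plane K n a b = ⊥ := by
  rw [plane, Submodule.span_eq_bot]
  rintro _ ⟨⟨⟨P, hP⟩, -⟩, rfl⟩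
  exfalso
  have := Finset.card_le_univ P
  rw [Fintype.card_fin] at this
  omega

/-- a sum of blocks `⨆_{a ∈ S} plane(a, k−a)` with `S ⊆ [0, k]` lies in `⋀^k`. -/
lemma biSup_plane_le_exteriorPower {k : ℕ} {S : Finset ℕ} (hS : ∀ a ∈ S, a ≤ k) :
    (⨆ a ∈ S, plane K n a (k - a)) ≤ ⋀[K]^k (In n → K) := by
  refine iSup₂_le fun a ha => ?_
  have := plane_le_exteriorPower K (n := n) a (k - a)
  rwa [show a + (k - a) = k by have := hS a ha; omega] at this

/-- a block whose x-count lies in `S` lies in the sum. -/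
lemma plane_le_biSup_plane {k a : ℕ} {S : Finset ℕ} (ha : a ∈ S) : plane K n a (k - a) ≤ ⨆ a ∈ S, plane K n a (k - a) :=
  le_iSup₂_of_le (f := fun a (_ : a ∈ S) => plane K n a (k - a)) a ha le_rfl

/-- **the projection onto a block whose x-count is NOT in `S` kills `⨆_{a ∈ S} plane(a, k−a)`** (E2: `prj` kills every other plane). -/
lemma prj_eq_zero_of_mem_biSup_plane {k c d : ℕ} {S : Finset ℕ} (hc : c ∉ S) {θ : HT K (In n)}
    (hθ : θ ∈ ⨆ a ∈ S, plane K n a (k - a)) : prj K n c d θ = 0 := by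
  have h : (⨆ a ∈ S, plane K n a (k - a)) ≤ LinearMap.ker (prj K n c d) := by
    refine iSup₂_le fun a ha => fun z hz => ?_
    rw [LinearMap.mem_ker]
    exact prj_of_mem_plane_ne K (Or.inl (by rintro rfl; exact hc ha)) hz
  exact h hθ

/-- **PROJECTION CRITERION**: a `θ ∈ ⋀^k` lies in `⨆_{a ∈ S} plane(a, k−a)` iff its components of x-count outside `S` vanish. -/
theorem mem_biSup_plane_iff {k : ℕ} (S : Finset ℕ) {θ : HT K (In n)} (hθ : θ ∈ ⋀[K]^k (In n → K)) :
    θ ∈ (⨆ a ∈ S, plane K n a (k - a)) ↔ ∀ c ≤ k, c ∉ S → prj K n c (k - c) θ = 0 := by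
  refine ⟨fun h c _ hc => prj_eq_zero_of_mem_biSup_plane K hc h, fun h => ?_⟩
  rw [← sum_prj K hθ]
  refine Submodule.sum_mem _ fun c hc => ?_
  rw [Finset.mem_range] at hc
  by_cases hcS : c ∈ S
  · exact plane_le_biSup_plane K hcS (prj_mem_plane K c (k - c) θ)
  · rw [h c (by omega) hcS]; exact Submodule.zero_mem _

/-- **THE BLOCKS ARE INDEPENDENT (intersection form): `(⨆_{a ∈ S} plane(a, k−a)) ⊓ (⨆_{a ∈ S′} plane(a, k−a)) = ⨆_{a ∈ S ∩ S′} plane(a, k−a)`**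
(`S ⊆ [0, k]`, so that the sums live in `⋀^k`). -/
theorem biSup_plane_inf {k : ℕ} {S S' : Finset ℕ} (hS : ∀ a ∈ S, a ≤ k) :
    (⨆ a ∈ S, plane K n a (k - a)) ⊓ (⨆ a ∈ S', plane K n a (k - a)) = ⨆ a ∈ S ∩ S', plane K n a (k - a) := by
  refine le_antisymm (fun θ hθ => ?_) (le_inf (iSup₂_le fun a ha => plane_le_biSup_plane K (Finset.mem_inter.mp ha).1)
    (iSup₂_le fun a ha => plane_le_biSup_plane K (Finset.mem_inter.mp ha).2))
  rw [Submodule.mem_inf] at hθ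
  rw [mem_biSup_plane_iff K (S ∩ S') (biSup_plane_le_exteriorPower K hS hθ.1)]
  intro c _ hc
  rw [Finset.mem_inter, not_and_or] at hc
  rcases hc with hc | hc
  · exact prj_eq_zero_of_mem_biSup_plane K hc hθ.1
  · exact prj_eq_zero_of_mem_biSup_plane K hc hθ.2

/-- **`yRich(k, P′)` BY x-COUNT: the blocks with FEWER THAN `k − P′` x-letters**, `yRich(k, P′) = ⨆_{a < k − P′} plane(a, k−a)`. -/
theorem yRich_eq_biSup (k P' : ℕ) : yRich K n k P' = ⨆ a ∈ Finset.range (k - P'), plane K n a (k - a) := by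
  refine le_antisymm (iSup₂_le fun b hb => ?_) (iSup₂_le fun a ha => ?_)
  · rw [Finset.mem_Ioc] at hb
    have := plane_le_biSup_plane K (n := n) (k := k) (S := Finset.range (k - P')) (a := k - b) (Finset.mem_range.mpr (by omega))
    rwa [show k - (k - b) = b by omega] at this
  · rw [Finset.mem_range] at ha
    have := plane_le_yRich K (n := n) (k := k) (P := P') (b := k - a) (by omega) (by omega)
    rwa [show k - (k - a) = a by omega] at this

/-- **`xyRich(k, P, P′) = xRich(k, P) ⊓ yRich(k, P′)`**: every monomial of a degree-`k` form has more than `P` x-letters and more than `P′` y-letters iff the form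
lies in both `xRich(k, P)` and `yRich(k, P′)` (E8's `xyRich_le` is `≤`; `≥` is the independence of the blocks). -/
theorem xyRich_eq_inf (k P P' : ℕ) : xyRich K n k P P' = xRich K n k P ⊓ yRich K n k P' := by
  refine le_antisymm (xyRich_le K k P P') ?_
  rw [xRich, yRich_eq_biSup, biSup_plane_inf K (fun a ha => (Finset.mem_Ioc.mp ha).2)]
  refine iSup₂_le fun a ha => ?_
  rw [Finset.mem_inter, Finset.mem_Ioc, Finset.mem_range] at ha
  exact plane_le_xyRich K ha.1.1 ha.1.2 (by omega)

/-- membership form: `θ ∈ xyRich(k, P, P′) ↔ θ ∈ xRich(k, P) ∧ θ ∈ yRich(k, P′)`. -/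
lemma mem_xyRich_iff {k P P' : ℕ} {θ : HT K (In n)} : θ ∈ xyRich K n k P P' ↔ θ ∈ xRich K n k P ∧ θ ∈ yRich K n k P' := by
  rw [xyRich_eq_inf, Submodule.mem_inf]

/-! ## §81. The block annihilator law -/

/-- **LETTER COUNT**: the blocks `plane(c, j−c)` with `a + c ≠ n` for every `a ∈ S` pair to zero with `⨆_{a ∈ S} plane(a, k−a)` — every product lands off the
top block `plane(n, n)`. -/
theorem biSup_plane_le_Ann {k j : ℕ} (S T : Finset ℕ) (hT : ∀ c ∈ T, c ≤ j ∧ ∀ a ∈ S, a + c ≠ n) :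
    (⨆ c ∈ T, plane K n c (j - c)) ≤ Ann K j (⨆ a ∈ S, plane K n a (k - a)) := by
  refine iSup₂_le fun c hc => ?_
  obtain ⟨hcj, hcS⟩ := hT c hc
  intro θ hθ
  refine mem_Ann.mpr ⟨?_, fun v hv => ?_⟩
  · have := plane_le_Hom K c (j - c) hθ
    rwa [show c + (j - c) = j by omega] at this
  · have key : (⨆ a ∈ S, plane K n a (k - a)) ≤ LinearMap.ker (topCoeff K ∘ₗ LinearMap.mulLeft K θ) := by
      refine iSup₂_le fun a ha => fun u hu => ?_
      rw [LinearMap.mem_ker, LinearMap.comp_apply, LinearMap.mulLeft_apply]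
      exact topCoeff_eq_zero_of_mem_plane K (Or.inl (by have := hcS a ha; omega)) (mul_mem_plane K hθ hu)
    have := key hv
    rwa [LinearMap.mem_ker, LinearMap.comp_apply, LinearMap.mulLeft_apply] at this

/-- **THE BLOCK ANNIHILATOR LAW: `Ann_j(⨆_{a ∈ S} plane(a, k−a)) = ⨆_{c ≤ j, a + c ≠ n ∀ a ∈ S} plane(c, j−c)`** for `k + j = 2n` (any finite set `S` of x-counts) — a
degree-`j` form pairs to zero with every block of x-count in `S` iff it has no component in the complementary blocks `plane(n − a, n − k + a)`, `a ∈ S`. -/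
theorem Ann_biSup_plane {k j : ℕ} (hkj : k + j = n + n) (S : Finset ℕ) :
    Ann K j (⨆ a ∈ S, plane K n a (k - a)) =
      ⨆ c ∈ (Finset.range (j + 1)).filter (fun c => ∀ a ∈ S, a + c ≠ n), plane K n c (j - c) := by
  refine le_antisymm (fun θ hθ => ?_) (biSup_plane_le_Ann K S _ fun c hc => ?_)
  swap
  · rw [Finset.mem_filter, Finset.mem_range] at hc; exact ⟨by omega, hc.2⟩
  obtain ⟨hθj, h0⟩ := mem_Ann.mp hθ
  rw [Hom_univ_eq_exteriorPower] at hθj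
  rw [← sum_prj K hθj]
  refine Submodule.sum_mem _ fun c hc => ?_
  rw [Finset.mem_range] at hc
  by_cases hcS : ∀ a ∈ S, a + c ≠ n
  · exact plane_le_biSup_plane K (Finset.mem_filter.mpr ⟨Finset.mem_range.mpr hc, hcS⟩) (prj_mem_plane K c (j - c) θ)
  · -- some `a ∈ S` has `a + c = n`: the component vanishes, by E1's non-degeneracy against the monomials of `plane(a, k − a)`
    push Not at hcS
    obtain ⟨a, haS, hac⟩ := hcS
    have hz : prj K n c (j - c) θ = 0 := by
      refine eq_zero_of_forall_top_mul_B K (a := j) (b := k) (by rw [Fintype.card_fin]; omega)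
        (by have := plane_le_Hom K c (j - c) (prj_mem_plane K c (j - c) θ); rwa [show c + (j - c) = j by omega] at this) fun U hU => ?_
      by_cases hcU : c + (Pof U).card = n
      · -- `E_U` has exactly `a` x-letters: it lies in the block sum, and `τ(θ ∧ E_U) = τ(prj θ ∧ E_U)`
        have hPQ := card_Pof_add_card_Qof U
        have h1 : B K (In n) U ∈ plane K n (Pof U).card (k - (Pof U).card) := B_mem_plane K rfl (by omega)
        rw [show (Pof U).card = a by omega] at h1
        rw [← topCoeff_mul_B_eq_topCoeff_prj_mul_B K hθj U hcU (by omega)]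
        exact h0 _ (plane_le_biSup_plane K haS h1)
      · exact topCoeff_eq_zero_of_mem_plane K (Or.inl hcU) (mul_mem_plane K (prj_mem_plane K c (j - c) θ) (B_mem_plane K rfl rfl))
    rw [hz]; exact Submodule.zero_mem _

/-- **THE ANNIHILATOR OF ONE BLOCK: `Ann_j(plane(a, k−a)) = ⨆_{c ≤ j, a + c ≠ n} plane(c, j−c)`** (`k + j = 2n`) — every block of the complementary degree except the
complementary block `plane(n−a, n−k+a)`. -/
theorem Ann_plane {k j : ℕ} (hkj : k + j = n + n) (a : ℕ) :
    Ann K j (plane K n a (k - a)) = ⨆ c ∈ (Finset.range (j + 1)).filter (fun c => a + c ≠ n), plane K n c (j - c) := by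
  have hS : plane K n a (k - a) = ⨆ b ∈ ({a} : Finset ℕ), plane K n b (k - b) := by
    refine le_antisymm (plane_le_biSup_plane K (Finset.mem_singleton_self a)) (iSup₂_le fun b hb => ?_)
    rw [Finset.mem_singleton] at hb; subst hb; exact le_rfl
  rw [hS, Ann_biSup_plane K hkj]
  refine le_antisymm (iSup₂_le fun c hc => ?_) (iSup₂_le fun c hc => ?_)
  · rw [Finset.mem_filter] at hc
    exact plane_le_biSup_plane K (Finset.mem_filter.mpr ⟨hc.1, hc.2 a (Finset.mem_singleton_self a)⟩)
  · rw [Finset.mem_filter] at hc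
    exact plane_le_biSup_plane K (Finset.mem_filter.mpr ⟨hc.1, fun b hb => by rw [Finset.mem_singleton] at hb; rw [hb]; exact hc.2⟩)

/-- **THE ANNIHILATOR OF `yRich`: `Ann_j(yRich(k, P′)) = yRich(j, n − P′ − 1)`** for `k + j = 2n`, `P′ < n` — a degree-`j` form pairs to zero with every degree-`k` form having more
than `P′` y-letters iff each of its monomials has at least `n − P′` y-letters (F4b's `Ann_xRich`, mirrored; here from the block law, no swap). -/
theorem Ann_yRich {k j P' : ℕ} (hkj : k + j = n + n) (hP' : P' < n) : Ann K j (yRich K n k P') = yRich K n j (n - P' - 1) := by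
  rw [yRich_eq_biSup, yRich_eq_biSup, Ann_biSup_plane K hkj]
  refine le_antisymm (iSup₂_le fun c hc => ?_) (iSup₂_le fun c hc => ?_)
  · rw [Finset.mem_filter, Finset.mem_range] at hc
    by_cases hcn : n < c
    · rw [plane_eq_bot_of_lt K hcn]; exact bot_le
    · have hlt : c < j - (n - P' - 1) := by
        by_contra hcon
        exact hc.2 (n - c) (Finset.mem_range.mpr (by omega)) (by omega)
      exact plane_le_biSup_plane K (Finset.mem_range.mpr hlt)
  · rw [Finset.mem_range] at hc
    refine plane_le_biSup_plane K (Finset.mem_filter.mpr ⟨Finset.mem_range.mpr (by omega), fun a ha => ?_⟩)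
    rw [Finset.mem_range] at ha
    omega

/-- **THE ANNIHILATOR OF `xyRich`: `Ann_j(xyRich(k, P, P′)) = xRich(j, n−P−1) ⊔ yRich(j, n−P′−1)`** for `k + j = 2n`, `P, P′ < n` — a degree-`j` form pairs to zero with every
form having more than `P` x-letters AND more than `P′` y-letters iff it is a sum of a form with at least `n − P` x-letters everywhere and one with at least `n − P′`
y-letters everywhere (E1's `Ann_inf` on §80's `xyRich = xRich ⊓ yRich`). -/
theorem Ann_xyRich {k j P P' : ℕ} (hkj : k + j = n + n) (hP : P < n) (hP' : P' < n) :
    Ann K j (xyRich K n k P P') = xRich K n j (n - P - 1) ⊔ yRich K n j (n - P' - 1) := by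
  rw [xyRich_eq_inf, Ann_inf K (a := j) (b := k) (by rw [Fintype.card_fin]; omega)
      (by rw [Hom_univ_eq_exteriorPower]; exact xRich_le_exteriorPower K k P)
      (by rw [Hom_univ_eq_exteriorPower]; exact yRich_le_exteriorPower K k P'),
    Ann_xRich K hkj hP, Ann_yRich K hkj hP']

/-- dually **`Ann_j(xRich(k, P) ⊔ yRich(k, P′)) = xyRich(j, n−P−1, n−P′−1)`** (`Ann_sup`). -/
theorem Ann_xRich_sup_yRich {k j P P' : ℕ} (hkj : k + j = n + n) (hP : P < n) (hP' : P' < n) :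
    Ann K j (xRich K n k P ⊔ yRich K n k P') = xyRich K n j (n - P - 1) (n - P' - 1) := by
  rw [Ann_sup, Ann_xRich K hkj hP, Ann_yRich K hkj hP', xyRich_eq_inf]

/-! ## §82. The image of a two-node class (nodes `0` and `∞`) in every degree `k′ ≥ P + P′ + 1` -/

/-- **THE IMAGE OF A TWO-NODE CLASS IN EVERY DEGREE: `V(univ, w_n(q), k′) = coSiegel(k′+n) ⊓ (xRich(k′+n, n−P−1) ⊔ yRich(k′+n, n−P′−1))`** for `q` supported on
`[0, P] ∪ [n−P′, n]` with `q_P ≠ 0`, `q_{n−P′} ≠ 0`, `k + k′ = n` and `P + P′ + 1 ≤ k′` — the co-Siegel forms that split as (at least `n − P` x-letters everywhere) + (at least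
`n − P′` y-letters everywhere).  E1's duality `V = Ann(Kr)` on E8's kernel law in the MIRROR degree `k = n − k′` (hypothesis `k + P + P′ + 1 ≤ n`): no upper bound
`P + P′ + 2 ≤ n + 1 − k′` is needed (F8's split name needs it). -/
theorem V_w_of_two_orders_eq {k k' P P' : ℕ} (hkk' : k + k' = n) (hPP' : P + P' + 1 ≤ k') {q : ℕ → K}
    (hq : ∀ j, P < j → j < n - P' → q j = 0) (hqP : q P ≠ 0) (hqP' : q (n - P') ≠ 0) :
    V K (In n) Finset.univ (w K n n q) k' =
      coSiegel K n (k' + n) ⊓ (xRich K n (k' + n) (n - P - 1) ⊔ yRich K n (k' + n) (n - P' - 1)) := by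
  rw [V_w_eq_Ann K hkk', Kr_w_eq_of_two_orders K (by omega) hq hqP hqP', Ann_sup, Ann_siegelIdeal K (by omega),
    Ann_xyRich K (by omega) (by omega) (by omega)]

/-- it depends only on `(P, P′, k′)`: two such classes with the same orders have the same images in every degree `k′ ≥ P + P′ + 1`. -/
theorem V_w_eq_V_w_of_two_orders {k k' P P' : ℕ} (hkk' : k + k' = n) (hPP' : P + P' + 1 ≤ k') {q q' : ℕ → K}
    (hq : ∀ j, P < j → j < n - P' → q j = 0) (hqP : q P ≠ 0) (hqP' : q (n - P') ≠ 0)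
    (hq' : ∀ j, P < j → j < n - P' → q' j = 0) (hqP2 : q' P ≠ 0) (hqP2' : q' (n - P') ≠ 0) :
    V K (In n) Finset.univ (w K n n q) k' = V K (In n) Finset.univ (w K n n q') k' := by
  rw [V_w_of_two_orders_eq K hkk' hPP' hq hqP hqP', V_w_of_two_orders_eq K hkk' hPP' hq' hqP2 hqP2']

/-- the split form is always contained: `(coSiegel ⊓ xRich(k′+n, n−P−1)) ⊔ (coSiegel ⊓ yRich(k′+n, n−P′−1)) ≤ V(univ, w_n(q), k′)` (`P + P′ + 1 ≤ k′`; equality is F8's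
`V_w_node_zero_add_rev_eq` in the range of the P¹ divisor rank law). -/
theorem sup_inf_le_V_w_of_two_orders {k k' P P' : ℕ} (hkk' : k + k' = n) (hPP' : P + P' + 1 ≤ k') {q : ℕ → K}
    (hq : ∀ j, P < j → j < n - P' → q j = 0) (hqP : q P ≠ 0) (hqP' : q (n - P') ≠ 0) :
    (coSiegel K n (k' + n) ⊓ xRich K n (k' + n) (n - P - 1)) ⊔ (coSiegel K n (k' + n) ⊓ yRich K n (k' + n) (n - P' - 1)) ≤
      V K (In n) Finset.univ (w K n n q) k' := by
  rw [V_w_of_two_orders_eq K hkk' hPP' hq hqP hqP']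
  exact sup_le (inf_le_inf_left _ le_sup_left) (inf_le_inf_left _ le_sup_right)

/-- the two single-node images sit inside: the node-`0` part `coSiegel(k′+n) ⊓ xRich(k′+n, n−P−1)` (F4b's name of the image of an order-`P` node at `0`) and the node-`∞` part
`coSiegel(k′+n) ⊓ yRich(k′+n, n−P′−1)` (F7) are both `≤ V(univ, w_n(q), k′)`. -/
theorem inf_xRich_le_V_w_of_two_orders {k k' P P' : ℕ} (hkk' : k + k' = n) (hPP' : P + P' + 1 ≤ k') {q : ℕ → K}
    (hq : ∀ j, P < j → j < n - P' → q j = 0) (hqP : q P ≠ 0) (hqP' : q (n - P') ≠ 0) :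
    coSiegel K n (k' + n) ⊓ xRich K n (k' + n) (n - P - 1) ≤ V K (In n) Finset.univ (w K n n q) k' ∧
      coSiegel K n (k' + n) ⊓ yRich K n (k' + n) (n - P' - 1) ≤ V K (In n) Finset.univ (w K n n q) k' := by
  have h := sup_inf_le_V_w_of_two_orders K hkk' hPP' hq hqP hqP'
  exact ⟨le_sup_left.trans h, le_sup_right.trans h⟩

end Summit.Ventures.HSemireg.Wedge.KernelDuality
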